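import Mathlib
import HarnessLib
import Summits.RiemannHypothesis.RiemannHypothesis.Theorems.IntegerScrewRungCertFast

/-!
# Route `IntegerScrew` — kernel certificate checker for the finite rungs: the WIDE PATH (any `N`), 1/2

The checkers of `IntegerScrewRungCert{Defs,Series,Sound,Fast}` carry the guard `N + 1 ≤ 64` because the
von Mangoldt values come from the fixed table `lamBase` (`n ≤ 64`). This file removes the cap so that rungs
beyond the cell's exact census (HOME/sos, engine A: `M ≤ 64` exact, `M ≤ 8 192` certified) can be imported:

* `lamTabOK` — the prime-power table becomes VALIDATED CERTIFICATE DATA: row `n ↦ (q, e, r)` claims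
  `Λ(n) = log q`, checked in the kernel by trial-division primality (`isPrimeB`) and `q ^ e = n`, or, when
  `q = 1`, by `n ≤ 1` or two distinct prime divisors `e, r` of `n` (`lamTabOK_sound`);
* `sqrtTabOK` — a validated table of two-sided enclosures of `√n` (two squarings per `n` instead of a
  130-step bisection at every use; `mem_of_sqrtTabOK`);
* `primeSumEnclW` / `uEnclW` / `uTableW` — the entry enclosures of part 1 on these tables (terms with
  `Λ(n) = 0` skipped; the accumulator forced at every step), soundness `mem_uEnclW`;
* the decision step (integer domination test in row chunks) and the main soundness theorem
  `posDef_of_rungW` are in the sequel `IntegerScrewRungCertWideCheck`; the packed literal tables and their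
  decoders live in the data files (`IntegerScrewRung128Data`).

Nothing here bears on the truth of RH (every rung is an RH-consequence made unconditional by computation).
References: S. M. Rump, Acta Numerica 19 (2010) §10.8 [folklore]; M. Suzuki, J. Lond. Math. Soc. (2) 108
(2023), (1.1), (1.4) [Suzuki2023].
-/

set_option linter.dupNamespace false

namespace Summit.RiemannHypothesis.RiemannHypothesis.Theorems.IntegerScrew.RungCert

open Literature.NumberTheory.LFunctions Literature.Analysis.ValidatedNumerics Finset
open Literature.Analysis.ValidatedNumerics.Numerics

/-! ## Validated von Mangoldt table -/

/-- `true` iff no `m` with `k ≤ m < k + f` divides `q` (trial division). [folklore] -/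
def noDivFrom (q : ℕ) : ℕ → ℕ → Bool
  | 0, _ => true
  | f + 1, k => !decide (q % k = 0) && noDivFrom q f (k + 1)

/-- Primality by trial division (kernel-friendly; used only on table entries). [folklore] -/
def isPrimeB (q : ℕ) : Bool := decide (2 ≤ q) && noDivFrom q (q - 2) 2

/-- Row `n` of the von Mangoldt table (junk `(1,0,0)` beyond it). [folklore] -/
def lamRow (L : List (ℕ × ℕ × ℕ)) (n : ℕ) : ℕ × ℕ × ℕ := L.getD n (1, 0, 0)

/-- The claimed base: `Λ(n) = log (lamG L n)`. [folklore] -/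
def lamG (L : List (ℕ × ℕ × ℕ)) (n : ℕ) : ℕ := (lamRow L n).1

/-- Validation of one row `(q, e, r)` for `n`: `q` prime with `q ^ e = n`, `e > 0`; or `q = 1` and either
`n ≤ 1` or `e ≠ r` are primes dividing `n`. [folklore] -/
def lamEntryOK (n : ℕ) (t : ℕ × ℕ × ℕ) : Bool :=
  if t.1 = 1 then
    decide (n ≤ 1) ||
      (isPrimeB t.2.1 && isPrimeB t.2.2 && decide (t.2.1 ≠ t.2.2) && decide (n % t.2.1 = 0) &&
        decide (n % t.2.2 = 0))
  else isPrimeB t.1 && decide (0 < t.2.1) && decide (t.1 ^ t.2.1 = n)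

/-- Validation of the rows `0, …, K`. [folklore] -/
def lamTabOK (L : List (ℕ × ℕ × ℕ)) : ℕ → Bool
  | 0 => lamEntryOK 0 (lamRow L 0)
  | K + 1 => lamEntryOK (K + 1) (lamRow L (K + 1)) && lamTabOK L K

/-- Invariant of `noDivFrom`. [folklore] -/
theorem noDivFrom_spec (q : ℕ) : ∀ f k : ℕ, noDivFrom q f k = true → ∀ m, k ≤ m → m < k + f → ¬m ∣ q
  | 0, k, _, m, h1, h2 => by omega
  | f + 1, k, h, m, h1, h2 => by
    simp only [noDivFrom, Bool.and_eq_true, Bool.not_eq_eq_eq_not, Bool.not_true,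
      decide_eq_false_iff_not] at h
    rcases Nat.eq_or_lt_of_le h1 with rfl | hlt
    · intro hd; exact h.1 (Nat.mod_eq_zero_of_dvd hd)
    · exact noDivFrom_spec q f (k + 1) h.2 m hlt (by omega)

/-- **Trial division is sound.** [folklore] -/
theorem prime_of_isPrimeB {q : ℕ} (h : isPrimeB q = true) : q.Prime := by
  simp only [isPrimeB, Bool.and_eq_true, decide_eq_true_eq] at h
  exact Nat.prime_def_lt'.2 ⟨h.1, fun m hm hmq => noDivFrom_spec q (q - 2) 2 h.2 m hm (by omega)⟩

/-- **One validated row gives the von Mangoldt value** (and the base stays inside the log table). [folklore] -/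
theorem lamEntryOK_sound {n : ℕ} {t : ℕ × ℕ × ℕ} (h : lamEntryOK n t = true) :
    (ArithmeticFunction.vonMangoldt n : ℝ) = Real.log t.1 ∧ t.1 ≤ max n 1 := by
  unfold lamEntryOK at h
  split_ifs at h with h1
  · rw [h1, Nat.cast_one, Real.log_one]
    refine ⟨?_, le_max_right _ _⟩
    simp only [Bool.or_eq_true, decide_eq_true_eq, Bool.and_eq_true] at h
    rcases h with hn | ⟨⟨⟨⟨hp, hq⟩, hne⟩, hdp⟩, hdq⟩
    · interval_cases n
      · simp
      · exact ArithmeticFunction.vonMangoldt_apply_one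
    · exact ArithmeticFunction.vonMangoldt_eq_zero_iff.2 (not_isPrimePow_of_two_primes
        (prime_of_isPrimeB hp) (prime_of_isPrimeB hq) hne (Nat.dvd_of_mod_eq_zero hdp)
        (Nat.dvd_of_mod_eq_zero hdq))
  · simp only [Bool.and_eq_true, decide_eq_true_eq] at h
    obtain ⟨⟨hp, he⟩, hpow⟩ := h
    have hP := prime_of_isPrimeB hp
    constructor
    · rw [← hpow, ArithmeticFunction.vonMangoldt_apply_pow (by omega),
        ArithmeticFunction.vonMangoldt_apply_prime hP]
    · rw [← hpow]
      exact (le_self_pow (by exact_mod_cast hP.one_lt.le) (by omega)).trans (le_max_left _ _)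

/-- **The validated table**: `Λ(n) = log (lamG L n)` and `lamG L n ≤ max n 1` for `n ≤ K`. [folklore] -/
theorem lamTabOK_sound {L : List (ℕ × ℕ × ℕ)} : ∀ {K : ℕ}, lamTabOK L K = true → ∀ {n : ℕ}, n ≤ K →
    (ArithmeticFunction.vonMangoldt n : ℝ) = Real.log (lamG L n) ∧ lamG L n ≤ max n 1
  | 0, h, n, hn => by
    obtain rfl : n = 0 := by omega
    exact lamEntryOK_sound (by simpa [lamTabOK] using h)
  | K + 1, h, n, hn => by
    simp only [lamTabOK, Bool.and_eq_true] at h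
    rcases Nat.eq_or_lt_of_le hn with rfl | hlt
    · exact lamEntryOK_sound h.1
    · exact lamTabOK_sound h.2 (by omega)

/-! ## Validated square-root table -/

/-- Validation of the entry `n` of a table of enclosures of `√n`: `lo ≤ 0 ∨ lo² ≤ n·SC²` and
`0 ≤ hi ∧ n·SC² ≤ hi²`. [folklore] -/
def sqrtEntryOK (sqs : List FI) (n : ℕ) : Bool :=
  (decide ((lg sqs n).lo ≤ 0) || decide ((lg sqs n).lo * (lg sqs n).lo ≤ ((n * SC * SC : ℕ) : ℤ))) &&
    decide (0 ≤ (lg sqs n).hi) && decide (((n * SC * SC : ℕ) : ℤ) ≤ (lg sqs n).hi * (lg sqs n).hi)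

/-- Validation of the entries `0, …, K`. [folklore] -/
def sqrtTabOK (sqs : List FI) : ℕ → Bool
  | 0 => sqrtEntryOK sqs 0
  | K + 1 => sqrtEntryOK sqs (K + 1) && sqrtTabOK sqs K

/-- One validated entry encloses `√n`. [folklore] -/
theorem mem_of_sqrtEntryOK {sqs : List FI} {n : ℕ} (h : sqrtEntryOK sqs n = true) :
    FI.mem (Real.sqrt n) (lg sqs n) := by
  simp only [sqrtEntryOK, Bool.and_eq_true, Bool.or_eq_true, decide_eq_true_eq] at h
  obtain ⟨⟨hlo, hhi0⟩, hhi⟩ := h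
  have hS := SC_pos
  have hsq : Real.sqrt n * SC = Real.sqrt ((n * SC * SC : ℕ) : ℝ) := by
    push_cast
    rw [show (n : ℝ) * SC * SC = (SC : ℝ) ^ 2 * n by ring, Real.sqrt_mul' _ (Nat.cast_nonneg n),
      Real.sqrt_sq hS.le, mul_comm]
  refine ⟨?_, ?_⟩
  · rw [hsq]
    rcases hlo with hlo | hlo
    · exact le_trans (by exact_mod_cast hlo) (Real.sqrt_nonneg _)
    · exact Real.le_sqrt_of_sq_le (by rw [sq]; exact_mod_cast hlo)
  · rw [hsq, Real.sqrt_le_left (by exact_mod_cast hhi0), sq]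
    exact_mod_cast hhi

/-- **The validated table encloses `√n` for `n ≤ K`.** [folklore] -/
theorem mem_of_sqrtTabOK {sqs : List FI} : ∀ {K : ℕ}, sqrtTabOK sqs K = true → ∀ {n : ℕ}, n ≤ K →
    FI.mem (Real.sqrt n) (lg sqs n)
  | 0, h, n, hn => by
    obtain rfl : n = 0 := by omega
    exact mem_of_sqrtEntryOK (by simpa [sqrtTabOK] using h)
  | K + 1, h, n, hn => by
    simp only [sqrtTabOK, Bool.and_eq_true] at h
    rcases Nat.eq_or_lt_of_le hn with rfl | hlt
    · exact mem_of_sqrtEntryOK h.1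
    · exact mem_of_sqrtTabOK h.2 (by omega)

/-! ## The entry enclosures on the validated tables -/

/-- One summand `Λ(n) n^{-1/2} (t − log n)` (exact zero when `Λ(n) = 0`). [folklore] -/
def primeTermW (L : List (ℕ × ℕ × ℕ)) (sqs logs : List FI) (T : FI) (n : ℕ) : FI :=
  if lamG L n = 1 then ⟨0, 0⟩
  else ((lg logs (lamG L n)).mul ((lg sqs n).divNat n)).mul (T.sub (lg logs n))

/-- `acc + Σ_{1 ≤ k ≤ n} primeTermW k`, the accumulator forced at every step. [folklore] -/
def primeStepW (L : List (ℕ × ℕ × ℕ)) (sqs logs : List FI) (T : FI) : ℕ → FI → FI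
  | 0, acc => acc
  | n + 1, acc =>
      if acc.hi < acc.lo then acc else primeStepW L sqs logs T n (acc.add (primeTermW L sqs logs T (n + 1)))

/-- Enclosure of the prime sum `Σ_{1 ≤ n ≤ m} Λ(n) n^{-1/2}(t − log n)`. [folklore] -/
def primeSumEnclW (L : List (ℕ × ℕ × ℕ)) (sqs logs : List FI) (T : FI) (m : ℕ) : FI :=
  primeStepW L sqs logs T m (FI.ofInt 0)

/-- `u(a,b)` enclosed on the validated tables, `K` Hurwitz–Lerch terms. [folklore] -/
def uEnclW (L : List (ℕ × ℕ × ℕ)) (sqs logs : List FI) (A : FI) (a b K : ℕ) : FI :=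
  let T := (lg logs a).sub (lg logs b)
  let g := (lg sqs a).mul (lg sqs b)
  let s := g.divNat b
  let s' := g.divNat a
  let arch := ((s.add s').sub (FI.ofInt 2)).mulInt 4
  let P := primeSumEnclW L sqs logs T (a / b)
  let lin := (T.mul A).divNat 2
  let ler := (s'.mul (lerchEnclK a b K)).divNat 4
  ((arch.sub P).sub lin).sub ler

/-- The table `utab[a][b] = uEnclW a b (ktab[a][b])`, `b < a ≤ N + 1`. [folklore] -/
def uTableW (L : List (ℕ × ℕ × ℕ)) (sqs logs : List FI) (A : FI) (N : ℕ) (ktab : List (List ℕ)) :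
    List (List FI) :=
  (List.range (N + 2)).map fun a => (List.range a).map fun b => uEnclW L sqs logs A a b (mget ktab a b)

/-- One summand is enclosed. [folklore] -/
theorem mem_primeTermW {L : List (ℕ × ℕ × ℕ)} {sqs logs : List FI} {K : ℕ}
    (hΛ : ∀ n ≤ K, (ArithmeticFunction.vonMangoldt n : ℝ) = Real.log (lamG L n) ∧ lamG L n ≤ max n 1)
    (hS : ∀ n ≤ K, FI.mem (Real.sqrt n) (lg sqs n)) (hL : ∀ n ≤ K, FI.mem (Real.log n) (lg logs n))
    {t : ℝ} {T : FI} (ht : FI.mem t T) {n : ℕ} (hn1 : 1 ≤ n) (hn : n ≤ K) :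
    FI.mem ((ArithmeticFunction.vonMangoldt n : ℝ) / Real.sqrt n * (t - Real.log n))
      (primeTermW L sqs logs T n) := by
  obtain ⟨hv, hle⟩ := hΛ n hn
  unfold primeTermW
  split_ifs with h1
  · rw [hv, h1, Nat.cast_one, Real.log_one, zero_div, zero_mul]
    exact ⟨by simp, by simp⟩
  · have hlam : lamG L n ≤ K := hle.trans (max_le hn (hn1.trans hn))
    have h := FI.mem_mul (FI.mem_mul (hL _ hlam) (FI.mem_divNat (hS n hn) hn1)) (FI.mem_sub ht (hL n hn))
    rw [hv]
    have e : Real.log (lamG L n) / Real.sqrt n * (t - Real.log n) =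
        Real.log (lamG L n) * (Real.sqrt n / n) * (t - Real.log n) := by
      rw [Real.sqrt_div_self']; ring
    rw [e]; exact h

/-- Invariant of `primeStepW`. [folklore] -/
theorem primeStepW_spec {L : List (ℕ × ℕ × ℕ)} {sqs logs : List FI} {K : ℕ}
    (hΛ : ∀ n ≤ K, (ArithmeticFunction.vonMangoldt n : ℝ) = Real.log (lamG L n) ∧ lamG L n ≤ max n 1)
    (hS : ∀ n ≤ K, FI.mem (Real.sqrt n) (lg sqs n)) (hL : ∀ n ≤ K, FI.mem (Real.log n) (lg logs n))
    {t : ℝ} {T : FI} (ht : FI.mem t T) : ∀ (m : ℕ) (acc : FI) (v : ℝ), FI.mem v acc → m ≤ K →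
    FI.mem (v + ∑ n ∈ Finset.Icc 1 m,
      (ArithmeticFunction.vonMangoldt n : ℝ) / Real.sqrt n * (t - Real.log n)) (primeStepW L sqs logs T m acc)
  | 0, acc, v, hv, _ => by simpa [primeStepW] using hv
  | m + 1, acc, v, hv, hm => by
    simp only [primeStepW]
    split_ifs with h
    · exfalso
      have := hv.1.trans hv.2
      exact absurd (by exact_mod_cast this : acc.lo ≤ acc.hi) (not_le.2 h)
    · have hterm := mem_primeTermW hΛ hS hL ht (n := m + 1) (by omega) hm
      have := primeStepW_spec hΛ hS hL ht m _ _ (FI.mem_add hv hterm) (by omega)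
      rw [Finset.sum_Icc_succ_top (by omega), add_comm (Finset.sum _ _) _, ← add_assoc]
      exact this

/-- **The prime sum is enclosed.** [folklore] -/
theorem mem_primeSumEnclW {L : List (ℕ × ℕ × ℕ)} {sqs logs : List FI} {K : ℕ}
    (hΛ : ∀ n ≤ K, (ArithmeticFunction.vonMangoldt n : ℝ) = Real.log (lamG L n) ∧ lamG L n ≤ max n 1)
    (hS : ∀ n ≤ K, FI.mem (Real.sqrt n) (lg sqs n)) (hL : ∀ n ≤ K, FI.mem (Real.log n) (lg logs n))
    {t : ℝ} {T : FI} (ht : FI.mem t T) {m : ℕ} (hm : m ≤ K) :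
    FI.mem (∑ n ∈ Finset.Icc 1 m, (ArithmeticFunction.vonMangoldt n : ℝ) / Real.sqrt n * (t - Real.log n))
      (primeSumEnclW L sqs logs T m) := by
  have := primeStepW_spec hΛ hS hL ht m (FI.ofInt 0) 0 (by simpa using FI.mem_ofInt 0) hm
  simpa [primeSumEnclW] using this

/-- **`u(a,b) ∈ uEnclW a b K`** (`1 ≤ b < a ≤ K`, validated tables, `A ∋` the slope). [folklore] -/
theorem mem_uEnclW {L : List (ℕ × ℕ × ℕ)} {sqs logs : List FI} {M : ℕ}
    (hΛ : ∀ n ≤ M, (ArithmeticFunction.vonMangoldt n : ℝ) = Real.log (lamG L n) ∧ lamG L n ≤ max n 1)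
    (hS : ∀ n ≤ M, FI.mem (Real.sqrt n) (lg sqs n)) (hL : ∀ n ≤ M, FI.mem (Real.log n) (lg logs n))
    {A : FI} (hA : FI.mem slopeA A) {a b : ℕ} (hb : 0 < b) (hab : b < a) (haM : a ≤ M) (K : ℕ) :
    FI.mem (uR a b) (uEnclW L sqs logs A a b K) := by
  have ha : 0 < a := hb.trans hab
  rw [uR_eq hb hab]
  have hT : FI.mem (Real.log a - Real.log b) ((lg logs a).sub (lg logs b)) :=
    FI.mem_sub (hL a haM) (hL b (by omega))
  have hg : FI.mem (Real.sqrt a * Real.sqrt b) ((lg sqs a).mul (lg sqs b)) :=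
    FI.mem_mul (hS a haM) (hS b (by omega))
  have hs : FI.mem (Real.sqrt a * Real.sqrt b / b) (((lg sqs a).mul (lg sqs b)).divNat b) :=
    FI.mem_divNat hg hb
  have hs' : FI.mem (Real.sqrt a * Real.sqrt b / a) (((lg sqs a).mul (lg sqs b)).divNat a) :=
    FI.mem_divNat hg ha
  have h2 : FI.mem (2 : ℝ) (FI.ofInt 2) := by simpa using FI.mem_ofInt 2
  have harch : FI.mem (4 * (Real.sqrt a * Real.sqrt b / b + Real.sqrt a * Real.sqrt b / a - 2))
      ((((((lg sqs a).mul (lg sqs b)).divNat b).add (((lg sqs a).mul (lg sqs b)).divNat a)).sub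
        (FI.ofInt 2)).mulInt 4) := by
    have := FI.mem_mulInt (FI.mem_sub (FI.mem_add hs hs') h2) 4
    push_cast at this
    rw [mul_comm] at this
    exact this
  have hP := mem_primeSumEnclW hΛ hS hL hT (m := a / b) ((Nat.div_le_self a b).trans haM)
  have hlin : FI.mem ((Real.log a - Real.log b) * slopeA / 2)
      ((((lg logs a).sub (lg logs b)).mul A).divNat 2) := FI.mem_divNat (FI.mem_mul hT hA) (by norm_num)
  have hler := FI.mem_divNat (FI.mem_mul hs' (mem_lerchEnclK hab K)) (n := 4) (by norm_num)
  have := FI.mem_sub (FI.mem_sub (FI.mem_sub harch hP) hlin) hler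
  push_cast at this ⊢
  exact this

/-- Table lookup in `uTableW`. [folklore] -/
theorem ug_uTableW {L : List (ℕ × ℕ × ℕ)} {sqs logs : List FI} {A : FI} {N : ℕ} {ktab : List (List ℕ)}
    {a b : ℕ} (hba : b < a) (ha : a ≤ N + 1) :
    ug (uTableW L sqs logs A N ktab) a b = uEnclW L sqs logs A a b (mget ktab a b) := by
  unfold ug uTableW
  have h1 : ((List.range (N + 2)).map fun a => (List.range a).map fun b =>
      uEnclW L sqs logs A a b (mget ktab a b)).getD a [] =
      (List.range a).map fun b => uEnclW L sqs logs A a b (mget ktab a b) := by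
    rw [List.getD_eq_getElem?_getD, List.getElem?_map, List.getElem?_range (by omega)]
    rfl
  rw [h1, List.getD_eq_getElem?_getD, List.getElem?_map, List.getElem?_range hba]
  rfl

-- build note (R14-3 append remedy, sos-eng-1 gen6 2026-08-24): comment-only re-land to trigger the hub build;
-- every declaration above is byte-identical to the accepted module.

end Summit.RiemannHypothesis.RiemannHypothesis.Theorems.IntegerScrew.RungCert
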